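import Literature.MathematicalPhysics.QuantumFieldTheory.Balaban1983to89.B6Cor28EntriesKLevelV1
import Literature.MathematicalPhysics.QuantumFieldTheory.Balaban1983to89.B16Ineq17MinimizerErrorVariational
import Literature.MathematicalPhysics.QuantumFieldTheory.Balaban1983to89.B6RandomWalkL2Hom

/-!
# `Balaban1983to89.B16Ineq17WholeTorusMajorants` — [Balaban1989LargeFieldII] p. 357 ∕ (1.7): THE WHOLE-TORUS HALF OF THE BLOCK-ℓ² MAJORANTS OF
# LETTER (c), BY NAME FROM [Balaban1984PropagatorsII] COROLLARY 2.8 AT k LEVELS — from flat ENTRY bounds `|(Te_c)(f)| ≤ Ce^{−δd}` and fibre bounds to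
# dag-n12-b's hom block-`ℓ²` majorants (Cauchy–Schwarz), and the instance at ROUTE V's trivial member `TDomains.top` (the whole torus) for the
# genuine `H = GQ*(QGQ*)⁻¹`

statement-level skeleton of published theorems with citation tags; proofs where landed; nothing here is a claim about
the Yang–Mills mass gap.

Cell pub-ymgap (D-0062 ∕ D-0149), seat `pub-ymgap-dag-n10-w3` g0 (REBALANCE № 10: START LIST §n12 letter (c); key K1⁷ stmt-QuantumFields-20542, helper,
count-neutral), item (M2b) of `HOME/pub-ymgap-dag-n10-w3/N12-LETTER-C-CENSUS.md`.  Sources: T. Bałaban, CMP **122** (1989) p. 357 («by the exponential decay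
of the minimizer»; «the kᵗʰ minimizer defined on the whole lattice»); T. Bałaban, CMP **96** (1984) [Balaban1984PropagatorsII] Corollary 2.8 (2.150)–(2.151)
p. 249 (the kernel of `H`), (2.52) p. 232 (blocks), (2.140) p. 247 (block-`ℓ²` norms); tree: r03's `B6Cor28EntriesKLevelV1.cor28_kLevel_H_DH` (the flat
entries of `H = GE ∘ QsE ∘ EE (domT hN D hk)` at ANY k-level torus family `D : TDomains`, hypothesis-free), `B6MultiLevelTorusOperator.TDomains.top` (the
family `Ω₁ = … = Ω_k = T_η`), `B6Prop27KLevelV1.card_fiber_beta_le` (≤ `2(d+1)` index bonds per block).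

WHAT THIS FILE PROVES (0 `sorry`, theorems only; axioms standard).
§1 (GENERIC, dag-n12-b's setting `g, blkX, blkF`) ★ `hasHomL2_of_entries`: ENTRY bounds `|(T(e_c))(f)| ≤ C·e^{−δ·d(blkF f, blkX c)}` + fibre bounds
   `#blkX⁻¹(y′) ≤ n_X`, `#blkF⁻¹(y) ≤ n_F` ⟹ the hom block-`ℓ²` majorant `‖Δ(y)(Tu)‖ ≤ C·√(n_X·n_F)·e^{−δd(y,y′)}·‖u‖` for `u` supported over the
   block `y′` — the hypothesis shape `hT ∕ hH` of `B16Ineq17ZetaError ∕ …MinimizerError(Variational)`.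
§2 (ROUTE V, any `TDomains`) `hasHomL2_H_of_cor28`: the §1 majorant for the genuine `H` from the first clause of `cor28_kLevel_H_DH` and the fibre bounds —
   `K(y,y′) = C·√(2(d+1)·n_F)·e^{−δ₅d_T(y,y′)}` with `n_F` any bound on the fine bonds per block (instance-free fibre hypotheses: no `Decidable`
   instance enters the statement); the WHOLE TORUS (*«the kᵗʰ minimizer defined on the whole lattice»*) is the member `D := TDomains.top d ℓ Mh k P′ R _`
   (`lev ≡ k`, (2.2) vacuous) — no separate corollary is stated.
§3 (EDITION 2) ★ `hasHomL2_DH_of_cor28`: the SECOND clause (2.151)₂ of `cor28_kLevel_H_DH` — for every direction `ν`, the §1 majorant for `∇_ν ∘ onFun H`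
   (`∇_ν = B6GradLegKLevelV1.DV ν c_f`) with `K = (C·ρ)·√(2(d+1)·n_F)·e^{−δ₅d_T}`, `ρ ≥ 0` any displayed bound on print's factor `(Lʲη)⁻¹ =
   (len(y(f))·|c_f|⁻¹)⁻¹` (constant at `top`) — this supersedes remark (ii) of the scope paragraph below, which describes edition 1.
§4 (EDITION 2) `card_fiber_blkV1_le`: at most `(d+1)·L^{(d+1)k}` fine bonds share a block (chart injective, `#B^j(y) = L^{j(d+1)}`, `j ≤ k`) — the
   displayed `n_F` of §2–§3 DISCHARGED.
§5 (EDITION 2) `hasL2MajorantHom_of_entries`, ★ `hasL2MajorantHom_H_of_cor28`, `hasL2MajorantHom_DH_of_cor28`: §1–§3 BY NAME in the tree's vocabulary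
   `B6RandomWalkL2Hom.HasL2MajorantHom blkX blkF T K` (whose definition unfolds to the §1–§3 conclusions verbatim), `n_F` discharged by §4 — the `H` form
   has the binders of `cor28_kLevel_H_DH` and nothing else — so that ROUTE V's majorant algebra (`hasL2MajorantHom_comp ∕ _add ∕ _of_emb`) applies.
HONEST SCOPE.  (i) The block volume `n_F` of fine bonds per unit block is DISPLAYED (at `top`, `n_F = (d+1)·L^{k(d+1)}`): in print's η-weighted norms it
cancels ((M2a) of the census — the consumer rescales `H′ := n_F^{−1∕2}•H`); unweighted here, as in the prequels.  (ii) Only the `H`-majorant (2.151)₁ is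
instantiated; the `∇H`-entries (2.151)₂ carry the factor `(L^jη)^{−1}` and are left to the consumer's `∂` (the `hT`-side), said.  (iii) The identification
of ROUTE V's `H` at `top` with [B5]'s `H_k` is p16's `B6SectAWholeTorusBridge.hOp_whole_eq_Hk` at p21's `Domains.whole` — a dictionary remark (the two
presentations of the trivial family), not re-proved here.  (iv) The REGION half (`H_{1,k,Z}`, Dirichlet level-0 layer) is (M1) of the census — NOT in the
tree.  Count-neutral; N12 NOT discharged; the Yang–Mills mass gap (Clay) is NOT proved by any of this — R4 closes the conditional finite-𝕋⁴ rung
`BalabanLadder.UV` only; nothing continuum ∕ ℝ⁴ ∕ OS.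
-/

noncomputable section

open scoped BigOperators
open Finset

namespace Literature.MathematicalPhysics.QuantumFieldTheory.Balaban1983to89.B16Ineq17WholeTorusMajorants

open B6RandomWalk (blockPiece)
open B6RandomWalkL2 (l2n l2n_nonneg l2n_sq)

/-! ## §1. From entry bounds to the hom block-`ℓ²` majorant -/

section Generic

variable {g : B6.Geometry} {X F : Type} [Fintype X] [Fintype F] [DecidableEq X] [DecidableEq g.Site]
  (blkX : X → g.Site) (blkF : F → g.Site)

/-- `u = Σ_c u(c)·e_c`. [folklore] -/
private theorem eq_sum_single (u : X → ℝ) : u = ∑ c : X, u c • (Pi.single c (1 : ℝ) : X → ℝ) := by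
  ext x
  simp [Finset.sum_apply, Pi.single_apply]

/-- ★ **ENTRY BOUNDS ⟹ HOM BLOCK-ℓ² MAJORANT** (Cauchy–Schwarz twice): if `|(T e_c)(f)| ≤ C·e^{−δ·d(blkF f, blkX c)}` for all `c, f`, at most `n_X`
indices `c` share a block and at most `n_F` fine points `f` share a block, then for `u` supported over the block `y′`,
`‖Δ(y)(Tu)‖ ≤ C·√(n_X·n_F)·e^{−δ·d(y,y′)}·‖u‖` — the hypothesis shape of dag-n12-b's `blockSchur`.
[cite: Balaban1984PropagatorsII, (2.151) p.249, (2.52) p.232, (2.140) p.247] -/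
theorem hasHomL2_of_entries (T : (X → ℝ) →ₗ[ℝ] (F → ℝ)) {C δ : ℝ} (hC : 0 ≤ C)
    (hent : ∀ (c : X) (f : F), |T (Pi.single c 1) f| ≤ C * Real.exp (-(δ * g.dist (blkF f) (blkX c))))
    {nX nF : ℕ} (hnX : ∀ (y' : g.Site) (s : Finset X), (∀ c ∈ s, blkX c = y') → s.card ≤ nX)
    (hnF : ∀ (y : g.Site) (s : Finset F), (∀ f ∈ s, blkF f = y) → s.card ≤ nF)
    (y y' : g.Site) (u : X → ℝ) (hu : ∀ x, blkX x ≠ y' → u x = 0) :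
    l2n (blockPiece blkF y (T u)) ≤ C * Real.sqrt (nX * nF) * Real.exp (-(δ * g.dist y y')) * l2n u := by
  classical
  -- pointwise: `|(Tu)(f)| ≤ C e^{−δ d(y,y′)} √nX ‖u‖` for `blkF f = y`
  have hpt : ∀ f : F, blkF f = y → |T u f| ≤ C * Real.exp (-(δ * g.dist y y')) * (Real.sqrt nX * l2n u) := by
    intro f hf
    have hexp : T u f = ∑ c : X, u c * T (Pi.single c 1) f := by
      conv_lhs => rw [eq_sum_single u, map_sum]
      simp [Finset.sum_apply, Pi.smul_apply, smul_eq_mul]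
    rw [hexp]
    -- restrict to the support block
    have hsum : ∑ c : X, u c * T (Pi.single c 1) f = ∑ c ∈ Finset.univ.filter (fun c => blkX c = y'), u c * T (Pi.single c 1) f := by
      rw [← Finset.sum_filter_add_sum_filter_not Finset.univ (fun c => blkX c = y')]
      simp only [add_eq_left]
      exact Finset.sum_eq_zero fun c hc => by rw [hu c (Finset.mem_filter.1 hc).2, zero_mul]
    rw [hsum]
    set S := Finset.univ.filter (fun c : X => blkX c = y') with hS
    calc |∑ c ∈ S, u c * T (Pi.single c 1) f|
        ≤ ∑ c ∈ S, |u c| * (C * Real.exp (-(δ * g.dist y y'))) := by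
          refine (Finset.abs_sum_le_sum_abs _ _).trans (Finset.sum_le_sum fun c hc => ?_)
          rw [abs_mul]
          refine mul_le_mul_of_nonneg_left ?_ (abs_nonneg _)
          have h := hent c f
          rw [hf, (Finset.mem_filter.1 hc).2] at h
          exact h
      _ = C * Real.exp (-(δ * g.dist y y')) * ∑ c ∈ S, |u c| := by rw [← Finset.sum_mul]; ring
      _ ≤ C * Real.exp (-(δ * g.dist y y')) * (Real.sqrt nX * l2n u) := by
          refine mul_le_mul_of_nonneg_left ?_ (by positivity)
          -- Cauchy–Schwarz: Σ_{c∈S}|u c| ≤ √#S · √(Σ u²) ≤ √nX ‖u‖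
          have hcs := Real.sum_mul_le_sqrt_mul_sqrt S (fun _ => (1 : ℝ)) (fun c => |u c|)
          have h1 : ∑ c ∈ S, (1 : ℝ) ^ 2 = (S.card : ℝ) := by simp
          have h2 : ∑ c ∈ S, |u c| ^ 2 ≤ l2n u ^ 2 := by
            rw [l2n_sq]
            calc ∑ c ∈ S, |u c| ^ 2 = ∑ c ∈ S, u c ^ 2 := Finset.sum_congr rfl fun c _ => sq_abs _
              _ ≤ ∑ c, u c ^ 2 := Finset.sum_le_sum_of_subset_of_nonneg (Finset.subset_univ _) fun c _ _ => sq_nonneg _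
          simp only [one_mul] at hcs
          rw [h1] at hcs
          calc ∑ c ∈ S, |u c| ≤ Real.sqrt S.card * Real.sqrt (∑ c ∈ S, |u c| ^ 2) := hcs
            _ ≤ Real.sqrt nX * l2n u := by
                have hSc : (S.card : ℝ) ≤ nX := by
                  exact_mod_cast hnX y' S (fun c hc => (Finset.mem_filter.1 hc).2)
                refine mul_le_mul (Real.sqrt_le_sqrt hSc) ?_ (Real.sqrt_nonneg _) (Real.sqrt_nonneg _)
                calc Real.sqrt (∑ c ∈ S, |u c| ^ 2) ≤ Real.sqrt (l2n u ^ 2) := Real.sqrt_le_sqrt h2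
                  _ = l2n u := Real.sqrt_sq (l2n_nonneg u)
  -- sum over the block `y`
  have hsq : l2n (blockPiece blkF y (T u)) ^ 2 ≤ (nF : ℝ) * (C * Real.exp (-(δ * g.dist y y')) * (Real.sqrt nX * l2n u)) ^ 2 := by
    rw [l2n_sq]
    have hterm : ∀ f : F, blockPiece blkF y (T u) f ^ 2 ≤
        if blkF f = y then (C * Real.exp (-(δ * g.dist y y')) * (Real.sqrt nX * l2n u)) ^ 2 else 0 := by
      intro f
      by_cases hf : blkF f = y
      · rw [if_pos hf]
        simp only [blockPiece, hf, if_true]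
        have h := hpt f hf
        have h0 : 0 ≤ C * Real.exp (-(δ * g.dist y y')) * (Real.sqrt nX * l2n u) := by
          have := l2n_nonneg u; positivity
        rw [← sq_abs]
        exact pow_le_pow_left₀ (abs_nonneg _) h 2
      · rw [if_neg hf]; simp [blockPiece, hf]
    calc ∑ f, blockPiece blkF y (T u) f ^ 2
        ≤ ∑ f, (if blkF f = y then (C * Real.exp (-(δ * g.dist y y')) * (Real.sqrt nX * l2n u)) ^ 2 else 0) :=
          Finset.sum_le_sum fun f _ => hterm f
      _ = ((Finset.univ.filter fun f : F => blkF f = y).card : ℝ) * (C * Real.exp (-(δ * g.dist y y')) * (Real.sqrt nX * l2n u)) ^ 2 := by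
          rw [Finset.sum_ite, Finset.sum_const_zero, add_zero, Finset.sum_const, nsmul_eq_mul]
      _ ≤ (nF : ℝ) * (C * Real.exp (-(δ * g.dist y y')) * (Real.sqrt nX * l2n u)) ^ 2 :=
          mul_le_mul_of_nonneg_right
            (by exact_mod_cast hnF y _ (fun f hf => (Finset.mem_filter.1 hf).2)) (sq_nonneg _)
  have hB : 0 ≤ C * Real.sqrt (nX * nF) * Real.exp (-(δ * g.dist y y')) * l2n u := by
    have := l2n_nonneg u; positivity
  refine (pow_le_pow_iff_left₀ (l2n_nonneg _) hB two_ne_zero).mp (hsq.trans (le_of_eq ?_))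
  have hnX0 : (0 : ℝ) ≤ nX := Nat.cast_nonneg _
  have hnF0 : (0 : ℝ) ≤ nF := Nat.cast_nonneg _
  rw [Real.sqrt_mul hnX0]
  have hsF : Real.sqrt (nF : ℝ) ^ 2 = nF := Real.sq_sqrt hnF0
  have hsX : Real.sqrt (nX : ℝ) ^ 2 = nX := Real.sq_sqrt hnX0
  calc (nF : ℝ) * (C * Real.exp (-(δ * g.dist y y')) * (Real.sqrt nX * l2n u)) ^ 2
      = Real.sqrt (nF : ℝ) ^ 2 * (C * Real.exp (-(δ * g.dist y y')) * (Real.sqrt nX * l2n u)) ^ 2 := by rw [hsF]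
    _ = (C * (Real.sqrt nX * Real.sqrt nF) * Real.exp (-(δ * g.dist y y')) * l2n u) ^ 2 := by ring

end Generic


/-! ## §2. The whole-torus (and any k-level) instance for the genuine `H`, by name from Corollary 2.8 -/

section RouteV

open LatticeFieldCalculus
open B6SectAOperatorsV1 (QsE BondIdx)
open B6SectAVectorModelV1 (GE EE)
open B6Ineq2133TwoScaleV1 (onFun onFun_apply)
open B6MultiLevelBoxOperator (N0)
open B6MultiLevelTorusOperator (TDomains)
open B6GlobalChartV1 (PV domT blkV1)
open B6Geom246MultiLevelTorus (geomT)
open B6Ineq2142KLevelV1 (β)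
open B6Prop27KLevelV1 (card_fiber_beta_le)
open B6CubeWindowV1 (Placed GlobalBand)
open B6Cover236MultiLevelBlocks (cubes)
open B6Cor28EntriesKLevelV1 (cor28_kLevel_H_DH)

variable {d ℓ : ℕ}

/-- ★ **THE `hH`-MAJORANT OF LETTER (c) FOR THE GENUINE `H = GQ*(QGQ*)⁻¹` AT ANY k-LEVEL TORUS FAMILY, BY NAME FROM COROLLARY 2.8**: binders of
`B6Cor28EntriesKLevelV1.cor28_kLevel_H_DH` VERBATIM; for every bound `n_F` on the fine bonds per block, the hom block-`ℓ²` majorant of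
`B16Ineq17MinimizerErrorVariational` holds for `onFun H` with `K(y,y′) = C·√(2(d+1)·n_F)·e^{−δ₅·d_T(y,y′)}` (index bonds: blocks `β`, ≤ `2(d+1)` per block by
`card_fiber_beta_le`; fine bonds: blocks `blkV1`).  At the trivial member `TDomains.top` this is *«the kᵗʰ minimizer defined on the whole lattice»*.
[cite: Balaban1984PropagatorsII, Cor. 2.8 (2.150)–(2.151) p.249, (2.52) p.232, (2.140) p.247; Balaban1989LargeFieldII, p.357] -/
theorem hasHomL2_H_of_cor28 (hd : 1 ≤ d + 1) (hL : Odd (ℓ + 1) ∧ 1 < ℓ + 1) {b₀ b₁ : ℝ} (hb₀ : 0 < b₀) (hb₁ : b₀ ≤ b₁) :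
    ∃ σ₁ : ℝ, 0 < σ₁ ∧ ∀ (σ : ℝ), 0 < σ → σ ≤ σ₁ → ∀ (α : ℝ), 0 < α → α < 1 →
    ∃ (δ₅ C M₂ : ℝ) (N₁ : ℕ), 0 < δ₅ ∧ 0 ≤ C ∧ 0 < M₂ ∧
    ∀ (m K : ℕ) {Mh k R : ℕ} {P' : Fin (d + 1) → ℕ}
      (hN : ∀ μ, N0 ℓ Mh k P' μ = (PV d ℓ m K hd hL).sitesPerDir 0) (D : TDomains d ℓ Mh k P' R) (hk : k ≤ m + K) (_ : 2 ≤ k)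
      {a : ℕ} (_ : Mh = (ℓ + 1) ^ a) (_ : 8 ≤ Mh) (_ : 2 * (ℓ + 1) ^ 2 ≤ R) (_ : ∀ μ, 5 ≤ P' μ) (_ : 4 ≤ ℓ)
      (_ : ∀ c : ↥(cubes D.toDomains), Placed ℓ k P' c.1) (_ : M₂ ≤ ((ℓ : ℝ) + 1) * Mh) (_ : N₁ + 1 ≤ R * ((ℓ + 1) * Mh))
      {cf : ℝ} (hcf : cf ≠ 0) {w : BondIdx (domT hN D hk) → ℝ} (hw : ∀ i, 0 < w i) (_ : GlobalBand b₀ b₁ cf w)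
      (nF : ℕ) (_ : ∀ (y : (geomT D).Site) (s : Finset (PBond (PV d ℓ m K hd hL) 0)), (∀ f ∈ s, blkV1 hN D f = y) → s.card ≤ nF),
      ∀ (y y' : (geomT D).Site) (u : BondIdx (domT hN D hk) → ℝ), (∀ c, β hN D hk c ≠ y' → u c = 0) →
        l2n (blockPiece (blkV1 hN D) y (onFun (GE (domT hN D hk) hcf hw ∘ₗ QsE (domT hN D hk) ∘ₗ EE (domT hN D hk) hcf hw) u))
          ≤ C * Real.sqrt ((2 * (d + 1) : ℕ) * nF) * Real.exp (-(δ₅ * (geomT D).dist y y')) * l2n u := by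
  obtain ⟨σ₁, hσ₁, h⟩ := cor28_kLevel_H_DH d ℓ hd hL hb₀ hb₁
  refine ⟨σ₁, hσ₁, fun σ hσ hσ1 α hα hα1 => ?_⟩
  obtain ⟨δ₅, C, M₂, N₁, hδ₅, hC, hM₂, hH⟩ := h σ hσ hσ1 α hα hα1
  refine ⟨δ₅, C, M₂, N₁, hδ₅, hC, hM₂, ?_⟩
  intro m K Mh k R P' hN D hk hk2 a hMha hM8 hR2 hP5 hℓ hpl hM hRM cf hcf w hw hwb nF hnF y y' u hu
  classical
  obtain ⟨hent, -⟩ := hH m K hN D hk hk2 hMha hM8 hR2 hP5 hℓ hpl hM hRM hcf hw hwb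
  have hnX : ∀ (y'' : (geomT D).Site) (s : Finset (BondIdx (domT hN D hk))), (∀ c ∈ s, β hN D hk c = y'') → s.card ≤ 2 * (d + 1) := by
    intro y'' s hs
    have h := card_fiber_beta_le hN D hk (le_trans one_le_two hk2) y''
    exact (Finset.card_le_card fun c hc => Finset.mem_filter.2 ⟨Finset.mem_univ _, hs c hc⟩).trans h
  have hent' : ∀ (c : BondIdx (domT hN D hk)) (f : PBond (PV d ℓ m K hd hL) 0),
      |onFun (GE (domT hN D hk) hcf hw ∘ₗ QsE (domT hN D hk) ∘ₗ EE (domT hN D hk) hcf hw) (Pi.single c 1) f| ≤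
        C * Real.exp (-(δ₅ * (geomT D).dist (blkV1 hN D f) (β hN D hk c))) := by
    intro c f
    rw [onFun_apply, PiLp.toLp_single]
    exact hent c f
  exact hasHomL2_of_entries (g := geomT D) (β hN D hk) (blkV1 hN D)
    (onFun (GE (domT hN D hk) hcf hw ∘ₗ QsE (domT hN D hk) ∘ₗ EE (domT hN D hk) hcf hw)) hC hent' hnX hnF y y' u hu

end RouteV

open LatticeFieldCalculus
open B6SectAOperatorsV1 (QsE BondIdx)
open B6SectAVectorModelV1 (GE EE)
open B6Ineq2133TwoScaleV1 (onFun onFun_apply)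
open B6MultiLevelBoxOperator (N0)
open B6MultiLevelTorusOperator (TDomains)
open B6GlobalChartV1 (PV domT blkV1 toBox toBox_injective)
open B6Geom246MultiLevelTorus (geomT)
open B6Ineq2142KLevelV1 (β)
open B6Prop27KLevelV1 (card_fiber_beta_le)
open B6CubeWindowV1 (Placed GlobalBand)
open B6Cover236MultiLevelBlocks (cubes)
open B6Cor28EntriesKLevelV1 (cor28_kLevel_H_DH)
open B6GradLegKLevelV1 (DV)
open B6Geom246MultiLevelBox (blkOf scale_bounds)
open B6QGQCoerciveMultiLevelBox (nb filter_blkOf_eq_image)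
open B4Reflection242 (boxDom)
open B6RandomWalkL2Hom (HasL2MajorantHom)

variable {d ℓ : ℕ}

/-! ## §3. (edition 2) The `∇H` clause (2.151)₂: the hom block-`ℓ²` majorant of `∇_ν ∘ H` -/

section RouteVGrad

/-- ★ **THE `∇H`-MAJORANT OF LETTER (c), BY NAME FROM THE SECOND CLAUSE (2.151)₂ OF COROLLARY 2.8**: binders of
`B6Cor28EntriesKLevelV1.cor28_kLevel_H_DH` VERBATIM; for every bound `n_F` on the fine bonds per block and every bound `ρ ≥ 0` on the printed factor
`(Lʲη)⁻¹ = (len(y(f))·|c_f|⁻¹)⁻¹` (a constant at the trivial member `TDomains.top`, where every block is a k-block), and every direction `ν`, the hom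
block-`ℓ²` majorant holds for `∇_ν ∘ onFun H` (`∇_ν = DV ν c_f`) with `K(y,y′) = (C·ρ)·√(2(d+1)·n_F)·e^{−δ₅·d_T(y,y′)}` — the `∇`-entries feeding the
consumer's assembly of the linearised field strength `∂ = d` (a signed sum of the `∇_ν`) in the `hT` letter of `B16Ineq17MinimizerErrorVariational`.
[cite: Balaban1984PropagatorsII, Cor. 2.8 (2.151) p.249 («|(∇H)(b,c)| ≤ O(1)(Lʲη)⁻¹(L^{j′}η)^{−d}e^{−δ₅d(y,c₋)}»), (2.140) p.247; Balaban1989LargeFieldII, p.357] -/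
theorem hasHomL2_DH_of_cor28 (hd : 1 ≤ d + 1) (hL : Odd (ℓ + 1) ∧ 1 < ℓ + 1) {b₀ b₁ : ℝ} (hb₀ : 0 < b₀) (hb₁ : b₀ ≤ b₁) :
    ∃ σ₁ : ℝ, 0 < σ₁ ∧ ∀ (σ : ℝ), 0 < σ → σ ≤ σ₁ → ∀ (α : ℝ), 0 < α → α < 1 →
    ∃ (δ₅ C M₂ : ℝ) (N₁ : ℕ), 0 < δ₅ ∧ 0 ≤ C ∧ 0 < M₂ ∧
    ∀ (m K : ℕ) {Mh k R : ℕ} {P' : Fin (d + 1) → ℕ}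
      (hN : ∀ μ, N0 ℓ Mh k P' μ = (PV d ℓ m K hd hL).sitesPerDir 0) (D : TDomains d ℓ Mh k P' R) (hk : k ≤ m + K) (_ : 2 ≤ k)
      {a : ℕ} (_ : Mh = (ℓ + 1) ^ a) (_ : 8 ≤ Mh) (_ : 2 * (ℓ + 1) ^ 2 ≤ R) (_ : ∀ μ, 5 ≤ P' μ) (_ : 4 ≤ ℓ)
      (_ : ∀ c : ↥(cubes D.toDomains), Placed ℓ k P' c.1) (_ : M₂ ≤ ((ℓ : ℝ) + 1) * Mh) (_ : N₁ + 1 ≤ R * ((ℓ + 1) * Mh))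
      {cf : ℝ} (hcf : cf ≠ 0) {w : BondIdx (domT hN D hk) → ℝ} (hw : ∀ i, 0 < w i) (_ : GlobalBand b₀ b₁ cf w)
      (nF : ℕ) (_ : ∀ (y : (geomT D).Site) (s : Finset (PBond (PV d ℓ m K hd hL) 0)), (∀ f ∈ s, blkV1 hN D f = y) → s.card ≤ nF)
      (ρ : ℝ) (_ : 0 ≤ ρ) (_ : ∀ f : PBond (PV d ℓ m K hd hL) 0, (((geomT D).len (blkV1 hN D f)) * |cf|⁻¹)⁻¹ ≤ ρ)
      (ν : Fin (d + 1)),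
      ∀ (y y' : (geomT D).Site) (u : BondIdx (domT hN D hk) → ℝ), (∀ c, β hN D hk c ≠ y' → u c = 0) →
        l2n (blockPiece (blkV1 hN D) y
          ((DV ν cf ∘ₗ onFun (GE (domT hN D hk) hcf hw ∘ₗ QsE (domT hN D hk) ∘ₗ EE (domT hN D hk) hcf hw)) u))
          ≤ C * ρ * Real.sqrt ((2 * (d + 1) : ℕ) * nF) * Real.exp (-(δ₅ * (geomT D).dist y y')) * l2n u := by
  obtain ⟨σ₁, hσ₁, h⟩ := cor28_kLevel_H_DH d ℓ hd hL hb₀ hb₁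
  refine ⟨σ₁, hσ₁, fun σ hσ hσ1 α hα hα1 => ?_⟩
  obtain ⟨δ₅, C, M₂, N₁, hδ₅, hC, hM₂, hH⟩ := h σ hσ hσ1 α hα hα1
  refine ⟨δ₅, C, M₂, N₁, hδ₅, hC, hM₂, ?_⟩
  intro m K Mh k R P' hN D hk hk2 a hMha hM8 hR2 hP5 hℓ hpl hM hRM cf hcf w hw hwb nF hnF ρ hρ0 hρ ν y y' u hu
  classical
  obtain ⟨-, hgrad⟩ := hH m K hN D hk hk2 hMha hM8 hR2 hP5 hℓ hpl hM hRM hcf hw hwb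
  have hnX : ∀ (y'' : (geomT D).Site) (s : Finset (BondIdx (domT hN D hk))), (∀ c ∈ s, β hN D hk c = y'') → s.card ≤ 2 * (d + 1) := by
    intro y'' s hs
    have h := card_fiber_beta_le hN D hk (le_trans one_le_two hk2) y''
    exact (Finset.card_le_card fun c hc => Finset.mem_filter.2 ⟨Finset.mem_univ _, hs c hc⟩).trans h
  have hent' : ∀ (c : BondIdx (domT hN D hk)) (f : PBond (PV d ℓ m K hd hL) 0),
      |(DV ν cf ∘ₗ onFun (GE (domT hN D hk) hcf hw ∘ₗ QsE (domT hN D hk) ∘ₗ EE (domT hN D hk) hcf hw)) (Pi.single c 1) f| ≤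
        C * ρ * Real.exp (-(δ₅ * (geomT D).dist (blkV1 hN D f) (β hN D hk c))) := by
    intro c f
    refine (hgrad ν c f).trans ?_
    rw [mul_assoc, mul_assoc]
    exact mul_le_mul_of_nonneg_left (mul_le_mul_of_nonneg_right (hρ f) (Real.exp_pos _).le) hC
  exact hasHomL2_of_entries (g := geomT D) (β hN D hk) (blkV1 hN D)
    (DV ν cf ∘ₗ onFun (GE (domT hN D hk) hcf hw ∘ₗ QsE (domT hN D hk) ∘ₗ EE (domT hN D hk) hcf hw)) (mul_nonneg hC hρ0) hent' hnX hnF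
    y y' u hu

end RouteVGrad

/-! ## §4. (edition 2) The fine-bond fibre count, discharging `n_F` -/

section Fiber

variable {m K : ℕ} {hd : 1 ≤ d + 1} {hL : Odd (ℓ + 1) ∧ 1 < ℓ + 1}

/-- **AT MOST `(d+1)·L^{(d+1)k}` FINE BONDS SHARE A BLOCK** (instance-free form, the `n_F`-hypothesis of §2–§3 discharged): a bond is `(b₋, μ)`, the chart
`toBox` is injective, the block `B^j(y)` is the image of its chart (`filter_blkOf_eq_image`, `#B^j(y) = L^{j(d+1)}`) and `j ≤ k`.
[cite: Balaban1984PropagatorsII, (2.1) p.224, (2.45) p.231, (2.69) p.235 (bookkeeping)] -/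
theorem card_fiber_blkV1_le {Mh k R : ℕ} {P' : Fin (d + 1) → ℕ}
    (hN : ∀ μ, N0 ℓ Mh k P' μ = (PV d ℓ m K hd hL).sitesPerDir 0) (D : TDomains d ℓ Mh k P' R)
    (y : (geomT D).Site) (s : Finset (PBond (PV d ℓ m K hd hL) 0)) (hs : ∀ f ∈ s, blkV1 hN D f = y) :
    s.card ≤ (d + 1) * (ℓ + 1) ^ ((d + 1) * k) := by
  classical
  set code : PBond (PV d ℓ m K hd hL) 0 → ↥(boxDom (N0 ℓ Mh k P')) × Fin (d + 1) := fun b => (toBox hN b.src, b.dir) with hcode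
  have hinj : Set.InjOn code ↑s := by
    intro b _ b' _ h
    simp only [hcode, Prod.mk.injEq] at h
    obtain ⟨h1, h2⟩ := h
    have hsrc : b.src = b'.src := toBox_injective hN h1
    cases b; cases b'
    simp only at hsrc h2
    rw [hsrc, h2]
  have himg : s.image code ⊆ (univ.filter fun x : ↥(boxDom (N0 ℓ Mh k P')) => blkOf D.toDomains x = y) ×ˢ univ := by
    intro p hp
    obtain ⟨b, hb, rfl⟩ := mem_image.1 hp
    simp only [hcode, mem_product, mem_filter, mem_univ, true_and, and_true]
    exact hs b hb
  have hblk : (univ.filter fun x : ↥(boxDom (N0 ℓ Mh k P')) => blkOf D.toDomains x = y).card ≤ (ℓ + 1) ^ ((d + 1) * k) := by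
    rw [filter_blkOf_eq_image]
    refine card_image_le.trans ?_
    rw [card_univ, Fintype.card_fun, Fintype.card_fin, Fintype.card_fin]
    unfold nb
    rw [← pow_mul, mul_comm]
    exact pow_le_pow_right₀ (by omega) (Nat.mul_le_mul_left _ (scale_bounds D.toDomains y).2)
  calc s.card = (s.image code).card := (card_image_of_injOn hinj).symm
    _ ≤ ((univ.filter fun x : ↥(boxDom (N0 ℓ Mh k P')) => blkOf D.toDomains x = y) ×ˢ (univ : Finset (Fin (d + 1)))).card :=
        card_le_card himg
    _ ≤ (ℓ + 1) ^ ((d + 1) * k) * (d + 1) := by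
        rw [card_product, card_univ, Fintype.card_fin]; exact Nat.mul_le_mul_right _ hblk
    _ = (d + 1) * (ℓ + 1) ^ ((d + 1) * k) := mul_comm _ _

end Fiber

/-! ## §5. (edition 2) The three majorants BY NAME in the tree's vocabulary `B6RandomWalkL2Hom.HasL2MajorantHom`, `n_F` discharged -/

section ByName

/-- §1 BY NAME: entry bounds + fibre bounds ⟹ `HasL2MajorantHom blkX blkF T (C·√(n_X n_F)·e^{−δd})` (the definition unfolds to `hasHomL2_of_entries`
verbatim). [cite: Balaban1984PropagatorsII, (2.151) p.249, (2.52) p.232, (2.140) p.247] -/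
theorem hasL2MajorantHom_of_entries {g : B6.Geometry} {X F : Type} [Fintype X] [Fintype F] [DecidableEq X] [DecidableEq g.Site]
    (blkX : X → g.Site) (blkF : F → g.Site) (T : (X → ℝ) →ₗ[ℝ] (F → ℝ)) {C δ : ℝ} (hC : 0 ≤ C)
    (hent : ∀ (c : X) (f : F), |T (Pi.single c 1) f| ≤ C * Real.exp (-(δ * g.dist (blkF f) (blkX c))))
    {nX nF : ℕ} (hnX : ∀ (y' : g.Site) (s : Finset X), (∀ c ∈ s, blkX c = y') → s.card ≤ nX)
    (hnF : ∀ (y : g.Site) (s : Finset F), (∀ f ∈ s, blkF f = y) → s.card ≤ nF) :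
    HasL2MajorantHom blkX blkF T (fun y y' => C * Real.sqrt (nX * nF) * Real.exp (-(δ * g.dist y y'))) :=
  fun y y' u hu => hasHomL2_of_entries blkX blkF T hC hent hnX hnF y y' u hu

/-- ★ §2 BY NAME, `n_F` DISCHARGED: `onFun H ≺₂ C·√(2(d+1)·(d+1)L^{(d+1)k})·e^{−δ₅d_T}` between the `β`-blocks and the `blkV1`-blocks, as
`HasL2MajorantHom (g := geomT D)` — binders of `cor28_kLevel_H_DH` verbatim and NOTHING ELSE; so ROUTE V's `hasL2MajorantHom_comp ∕ _add ∕ _of_emb` algebra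
applies to letter (c)'s `H` (the `√`-volume factor is print's `(L^kη)^{−d}`-weight read in unweighted `ℓ²`, (M2a) of the census).
[cite: Balaban1984PropagatorsII, Cor. 2.8 (2.150)–(2.151) p.249, (2.140) p.247; Balaban1989LargeFieldII, p.357] -/
theorem hasL2MajorantHom_H_of_cor28 (hd : 1 ≤ d + 1) (hL : Odd (ℓ + 1) ∧ 1 < ℓ + 1) {b₀ b₁ : ℝ} (hb₀ : 0 < b₀) (hb₁ : b₀ ≤ b₁) :
    ∃ σ₁ : ℝ, 0 < σ₁ ∧ ∀ (σ : ℝ), 0 < σ → σ ≤ σ₁ → ∀ (α : ℝ), 0 < α → α < 1 →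
    ∃ (δ₅ C M₂ : ℝ) (N₁ : ℕ), 0 < δ₅ ∧ 0 ≤ C ∧ 0 < M₂ ∧
    ∀ (m K : ℕ) {Mh k R : ℕ} {P' : Fin (d + 1) → ℕ}
      (hN : ∀ μ, N0 ℓ Mh k P' μ = (PV d ℓ m K hd hL).sitesPerDir 0) (D : TDomains d ℓ Mh k P' R) (hk : k ≤ m + K) (_ : 2 ≤ k)
      {a : ℕ} (_ : Mh = (ℓ + 1) ^ a) (_ : 8 ≤ Mh) (_ : 2 * (ℓ + 1) ^ 2 ≤ R) (_ : ∀ μ, 5 ≤ P' μ) (_ : 4 ≤ ℓ)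
      (_ : ∀ c : ↥(cubes D.toDomains), Placed ℓ k P' c.1) (_ : M₂ ≤ ((ℓ : ℝ) + 1) * Mh) (_ : N₁ + 1 ≤ R * ((ℓ + 1) * Mh))
      {cf : ℝ} (hcf : cf ≠ 0) {w : BondIdx (domT hN D hk) → ℝ} (hw : ∀ i, 0 < w i) (_ : GlobalBand b₀ b₁ cf w),
      HasL2MajorantHom (g := geomT D) (β hN D hk) (blkV1 hN D)
        (onFun (GE (domT hN D hk) hcf hw ∘ₗ QsE (domT hN D hk) ∘ₗ EE (domT hN D hk) hcf hw))
        (fun y y' => C * Real.sqrt ((2 * (d + 1) : ℕ) * ((d + 1) * (ℓ + 1) ^ ((d + 1) * k) : ℕ)) *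
          Real.exp (-(δ₅ * (geomT D).dist y y'))) := by
  obtain ⟨σ₁, hσ₁, h⟩ := hasHomL2_H_of_cor28 (d := d) (ℓ := ℓ) hd hL hb₀ hb₁
  refine ⟨σ₁, hσ₁, fun σ hσ hσ1 α hα hα1 => ?_⟩
  obtain ⟨δ₅, C, M₂, N₁, hδ₅, hC, hM₂, hH⟩ := h σ hσ hσ1 α hα hα1
  refine ⟨δ₅, C, M₂, N₁, hδ₅, hC, hM₂, ?_⟩
  intro m K Mh k R P' hN D hk hk2 a hMha hM8 hR2 hP5 hℓ hpl hM hRM cf hcf w hw hwb y y' u hu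
  exact hH m K hN D hk hk2 hMha hM8 hR2 hP5 hℓ hpl hM hRM hcf hw hwb _ (card_fiber_blkV1_le hN D) y y' u hu

/-- §3 BY NAME, `n_F` DISCHARGED: `∇_ν ∘ onFun H ≺₂ (C·ρ)·√(2(d+1)·(d+1)L^{(d+1)k})·e^{−δ₅d_T}` as `HasL2MajorantHom (g := geomT D)`, binders of
`cor28_kLevel_H_DH` verbatim + the displayed `ρ ≥ (Lʲη)⁻¹`. [cite: Balaban1984PropagatorsII, Cor. 2.8 (2.151) p.249, (2.140) p.247; Balaban1989LargeFieldII, p.357] -/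
theorem hasL2MajorantHom_DH_of_cor28 (hd : 1 ≤ d + 1) (hL : Odd (ℓ + 1) ∧ 1 < ℓ + 1) {b₀ b₁ : ℝ} (hb₀ : 0 < b₀) (hb₁ : b₀ ≤ b₁) :
    ∃ σ₁ : ℝ, 0 < σ₁ ∧ ∀ (σ : ℝ), 0 < σ → σ ≤ σ₁ → ∀ (α : ℝ), 0 < α → α < 1 →
    ∃ (δ₅ C M₂ : ℝ) (N₁ : ℕ), 0 < δ₅ ∧ 0 ≤ C ∧ 0 < M₂ ∧
    ∀ (m K : ℕ) {Mh k R : ℕ} {P' : Fin (d + 1) → ℕ}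
      (hN : ∀ μ, N0 ℓ Mh k P' μ = (PV d ℓ m K hd hL).sitesPerDir 0) (D : TDomains d ℓ Mh k P' R) (hk : k ≤ m + K) (_ : 2 ≤ k)
      {a : ℕ} (_ : Mh = (ℓ + 1) ^ a) (_ : 8 ≤ Mh) (_ : 2 * (ℓ + 1) ^ 2 ≤ R) (_ : ∀ μ, 5 ≤ P' μ) (_ : 4 ≤ ℓ)
      (_ : ∀ c : ↥(cubes D.toDomains), Placed ℓ k P' c.1) (_ : M₂ ≤ ((ℓ : ℝ) + 1) * Mh) (_ : N₁ + 1 ≤ R * ((ℓ + 1) * Mh))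
      {cf : ℝ} (hcf : cf ≠ 0) {w : BondIdx (domT hN D hk) → ℝ} (hw : ∀ i, 0 < w i) (_ : GlobalBand b₀ b₁ cf w)
      (ρ : ℝ) (_ : 0 ≤ ρ) (_ : ∀ f : PBond (PV d ℓ m K hd hL) 0, (((geomT D).len (blkV1 hN D f)) * |cf|⁻¹)⁻¹ ≤ ρ)
      (ν : Fin (d + 1)),
      HasL2MajorantHom (g := geomT D) (β hN D hk) (blkV1 hN D)
        (DV ν cf ∘ₗ onFun (GE (domT hN D hk) hcf hw ∘ₗ QsE (domT hN D hk) ∘ₗ EE (domT hN D hk) hcf hw))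
        (fun y y' => C * ρ * Real.sqrt ((2 * (d + 1) : ℕ) * ((d + 1) * (ℓ + 1) ^ ((d + 1) * k) : ℕ)) *
          Real.exp (-(δ₅ * (geomT D).dist y y'))) := by
  obtain ⟨σ₁, hσ₁, h⟩ := hasHomL2_DH_of_cor28 (d := d) (ℓ := ℓ) hd hL hb₀ hb₁
  refine ⟨σ₁, hσ₁, fun σ hσ hσ1 α hα hα1 => ?_⟩
  obtain ⟨δ₅, C, M₂, N₁, hδ₅, hC, hM₂, hH⟩ := h σ hσ hσ1 α hα hα1
  refine ⟨δ₅, C, M₂, N₁, hδ₅, hC, hM₂, ?_⟩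
  intro m K Mh k R P' hN D hk hk2 a hMha hM8 hR2 hP5 hℓ hpl hM hRM cf hcf w hw hwb ρ hρ0 hρ ν y y' u hu
  exact hH m K hN D hk hk2 hMha hM8 hR2 hP5 hℓ hpl hM hRM hcf hw hwb _ (card_fiber_blkV1_le hN D) ρ hρ0 hρ ν y y' u hu

end ByName

end Literature.MathematicalPhysics.QuantumFieldTheory.Balaban1983to89.B16Ineq17WholeTorusMajorants

end
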